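import Literature.NumberTheory.EllipticCurves.Kato2004.EulerSystemValues
import Mathlib.NumberTheory.DirichletCharacter.Orthogonality
import Mathlib.RingTheory.RootsOfUnity.AlgebraicallyClosed
import Mathlib.NumberTheory.GaussSum
import Mathlib.Analysis.SpecialFunctions.Complex.CircleAddChar
import HarnessLib

/-!
# Fourier inversion for Kato's character sums `Σ_b χ(b) ι(σ_b x)` on `(ℤ/m)ˣ`
# (cell `b2b-bsdres`, team n1011, ROUTE-1 PORT anatomy (P-KIM) = `cells/n1011/skel/T-PORT-1-PKIM.md`
# §3 item (K-i) / §5 file PK-2; OWNERS row T-PKIM-K12, file F-A; seat p15 GEN 9)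

HONEST FRAMING (cell `b2b-bsdres`, run/shared/lean/b2b/bsd-rank1-residual/, verbatim in every
file): the goal of the cell is to DELETE the COMBINATION-SHAPED residual classes of the
Birch–Swinnerton-Dyer formula for ALL analytic-rank `≤ 1` elliptic curves over `ℚ` — "full BSD
formula for every rank `≤ 1` curve in class `C`" assembled STRICTLY from published theorems — so
that the rank-`≤ 1` remainder becomes exactly the CONSTRUCTION-SHAPED classes, which are TYPED
(missing-input `Prop`s), NOT attempted. This is not "finishing BSD". Team n1011 (N10/N11; ROUTE 1,
the PORT anatomy (P-KIM) of class X4 ∧ `p = 3`): research route on CONSTRUCTION-SHAPED classes;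
prove what is provable now; no claim beyond stated classes; census output = EVIDENCE, never a
Literature fact; RESIDUAL-MAP marks UNCHANGED; nothing is booked by this file. TOOL THEOREMS ONLY:
no definition, no named fact, no instance, no `sorry`.

## What

The landed fact `Kato2004.ZetaBody` (`Literature/…/Kato2004/EulerSystemValues.lean`, p316481)
describes Kato's rational value `x = x_{k,r} ∈ ℚ(ζ_m)` ONLY through its character sums
`charSum m ι χ x = Σ_{b ∈ (ℤ/m)ˣ} χ(b) · ι(σ_b x)` (clause C5: one identity for EVERY Dirichlet
character `χ` mod `m`). The PORT's value clause (DICT3) needs the single conjugates `ι(σ_b x)` /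
the group-ring coefficients of `x`. This file is the elementary bridge — Fourier inversion on the
finite abelian group `(ℤ/m)ˣ` (orthogonality of Dirichlet characters, Mathlib
`DirichletCharacter.sum_char_inv_mul_char_eq`, over `ℂ` which has enough roots of unity):

* `totient_mul_apply_sigma_eq_sum_charSum` — **`φ(m) · ι(σ_b x) = Σ_χ χ(b)⁻¹ · charSum m ι χ x`**;
* `charSum_sigma` — `charSum m ι χ (σ_c x) = χ(c)⁻¹ · charSum m ι χ x` (the `χ`-component of a
  translate);
* `apply_sigma_eq_of_forall_charSum_eq` / `eq_of_forall_charSum_eq` — two elements with the same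
  character sums at EVERY `χ` have the same conjugates under `ι`, hence are EQUAL (`ι` is injective
  on the field `ℚ(ζ_m)`); `charSum_eq_zero_iff`-type corollary `eq_zero_of_forall_charSum_eq_zero`;
* `charSum_sum_smul_sigma` — the group-ring dictionary
  `charSum χ (Σ_a X(a) σ_a z) = (Σ_a χ(a)⁻¹ X(a)) · charSum χ z`, and `charSum_zeta`
  (`charSum χ ζ_m = Σ_c χ(c) ι(ζ_m)^c`, a Gauss-type sum); linearity lemmas `charSum_add/zero/smul/
  finset_sum`;
* `charSum_zeta_eq_inv_mul_gaussSum` — for `ι(ζ_m) = e^{2πi u/m}` (every `ι` is so normalised by a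
  unit `u`: `exists_units_apply_zeta_eq_exp`), `charSum χ ζ_m = χ(u)⁻¹ · gaussSum χ e_m` with Mathlib's
  `gaussSum χ ZMod.stdAddChar` — the Gauss sum of the tree's Birch formula `twisted_LValue_eq`.

Consumer (by name, when the lead deals it): PK-6 `KatoKuriharaDictionaryThreeAt_of_zetaBody`
(skel/T-PORT-1-PKIM.md §5), together with p13's PK-3 `mul_prod_deriv_eq_taylorCoeff_univ_smul_norm`
and F-B/F-C of this row. HONEST LIMITS: nothing about `ZetaBody`, Euler systems, `exp*`,
`L`-values or Kolyvagin systems is used or proved here; closes nothing; books nothing.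

References: K. Kato, Astérisque 295 (2004) Thm. 6.6 (1) p. 163 (the character sums), (5.7.1)
p. 157 (`σ_b`) [Kato2004Asterisque]; orthogonality of characters of a finite abelian group
[folklore].
-/

noncomputable section

open scoped BigOperators

namespace Summit.BirchSwinnertonDyer.Rank1Residual.GaloisImage

namespace CharSum

open Literature.NumberTheory.EllipticCurves.Kato2004.EulerSystemValues

variable (m : ℕ) [NeZero m] (ι : CyclotomicField m ℚ →+* ℂ)

omit [NeZero m] in
/-- `ℂ` has enough roots of unity of order the exponent of `(ℤ/m)ˣ` (a separably closed field of
characteristic zero has enough `n`-th roots of unity for every `n ≠ 0`). [folklore] -/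
theorem hasEnoughRootsOfUnity_exponent_units :
    HasEnoughRootsOfUnity ℂ (Monoid.exponent (ZMod m)ˣ) := by
  haveI : NeZero (Monoid.exponent (ZMod m)ˣ) := ⟨Monoid.exponent_ne_zero_of_finite⟩
  infer_instance

/-- `σ_b ∘ σ_c = σ_{bc}` on `ℚ(ζ_m)` (both raise every `m`-th root of unity to the power `bc`).
[cite: Kato2004Asterisque, (5.7.1) (p. 157)] -/
theorem sigma_mul_apply (b c : (ZMod m)ˣ) (x : CyclotomicField m ℚ) :
    sigma m (b * c) x = sigma m b (sigma m c x) := by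
  have key : sigma m (b * c) = (sigma m c).trans (sigma m b) := by
    unfold sigma
    rw [map_mul]
    rfl
  rw [key]
  rfl

/-- **Translation law**: `charSum m ι χ (σ_c x) = χ(c)⁻¹ · charSum m ι χ x` — reindex `b ↦ b c⁻¹`
in `Σ_b χ(b) ι(σ_b σ_c x) = Σ_b χ(b) ι(σ_{bc} x)`. [cite: Kato2004Asterisque, Thm. 6.6 (1) (p. 163)] -/
theorem charSum_sigma (χ : DirichletCharacter ℂ m) (c : (ZMod m)ˣ) (x : CyclotomicField m ℚ) :
    charSum m ι χ (sigma m c x) = χ⁻¹ (c : ZMod m) * charSum m ι χ x := by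
  unfold charSum
  symm
  rw [Finset.mul_sum, ← Equiv.sum_comp (Equiv.mulRight c)]
  refine Finset.sum_congr rfl fun b _ => ?_
  simp only [Equiv.coe_mulRight]
  rw [sigma_mul_apply, Units.val_mul, map_mul]
  -- `χ⁻¹(c) · (χ(b) χ(c)) = χ(b)`
  have hc : χ⁻¹ (c : ZMod m) * χ (c : ZMod m) = 1 := by
    rw [← MulChar.mul_apply, inv_mul_cancel, MulChar.one_apply_coe]
  calc χ⁻¹ (c : ZMod m) * (χ (b : ZMod m) * χ (c : ZMod m) * ι (sigma m b (sigma m c x)))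
      = (χ⁻¹ (c : ZMod m) * χ (c : ZMod m)) * (χ (b : ZMod m) * ι (sigma m b (sigma m c x))) := by
        ring
    _ = χ (b : ZMod m) * ι (sigma m b (sigma m c x)) := by rw [hc, one_mul]

omit [NeZero m] in
/-- `χ⁻¹(b) = χ(b⁻¹)` for a unit `b` (the inverse character evaluated at a unit). [folklore] -/
theorem inv_apply_coe_units (χ : DirichletCharacter ℂ m) (b : (ZMod m)ˣ) :
    χ⁻¹ (b : ZMod m) = χ ((b : ZMod m)⁻¹) := by
  rw [MulChar.inv_apply, Ring.inverse_unit, ZMod.inv_coe_unit]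

/-- **Fourier inversion on `(ℤ/m)ˣ`**: `φ(m) · ι(σ_b x) = Σ_χ χ(b)⁻¹ · charSum m ι χ x`, the sum
over all Dirichlet characters `χ` mod `m` with values in `ℂ` (orthogonality
`Σ_χ χ(b)⁻¹ χ(c) = φ(m) · [b = c]`). [folklore] -/
theorem totient_mul_apply_sigma_eq_sum_charSum (b : (ZMod m)ˣ) (x : CyclotomicField m ℚ) :
    (m.totient : ℂ) * ι (sigma m b x) =
      ∑ χ : DirichletCharacter ℂ m, χ⁻¹ (b : ZMod m) * charSum m ι χ x := by
  haveI := hasEnoughRootsOfUnity_exponent_units m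
  unfold charSum
  simp_rw [Finset.mul_sum, ← mul_assoc]
  rw [Finset.sum_comm]
  simp_rw [← Finset.sum_mul]
  have horth : ∀ c : (ZMod m)ˣ,
      ∑ χ : DirichletCharacter ℂ m, χ⁻¹ (b : ZMod m) * χ (c : ZMod m) =
        if (b : ZMod m) = c then (m.totient : ℂ) else 0 := by
    intro c
    have h := DirichletCharacter.sum_char_inv_mul_char_eq ℂ (Units.isUnit b) (c : ZMod m)
    simp_rw [inv_apply_coe_units]
    exact h
  simp_rw [horth]
  rw [Finset.sum_eq_single b]
  · simp
  · intro c _ hcb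
    rw [if_neg (fun h => hcb (Units.ext h).symm), zero_mul]
  · intro hb
    exact absurd (Finset.mem_univ b) hb

/-- **Equal character sums ⟹ equal conjugates**: if `charSum m ι χ x = charSum m ι χ y` for EVERY
Dirichlet character `χ` mod `m`, then `ι(σ_b x) = ι(σ_b y)` for every `b`. [folklore] -/
theorem apply_sigma_eq_of_forall_charSum_eq {x y : CyclotomicField m ℚ}
    (h : ∀ χ : DirichletCharacter ℂ m, charSum m ι χ x = charSum m ι χ y) (b : (ZMod m)ˣ) :
    ι (sigma m b x) = ι (sigma m b y) := by
  have hφ : (m.totient : ℂ) ≠ 0 := by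
    exact_mod_cast (Nat.totient_pos.mpr (NeZero.pos m)).ne'
  have key := totient_mul_apply_sigma_eq_sum_charSum m ι b x
  rw [show (∑ χ : DirichletCharacter ℂ m, χ⁻¹ (b : ZMod m) * charSum m ι χ x) =
      ∑ χ : DirichletCharacter ℂ m, χ⁻¹ (b : ZMod m) * charSum m ι χ y from
      Finset.sum_congr rfl fun χ _ => by rw [h χ],
    ← totient_mul_apply_sigma_eq_sum_charSum m ι b y] at key
  exact mul_left_cancel₀ hφ key

/-- **Equal character sums ⟹ equal elements** (`ι : ℚ(ζ_m) → ℂ` is injective, `σ_1 = id`).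
[folklore] -/
theorem eq_of_forall_charSum_eq {x y : CyclotomicField m ℚ}
    (h : ∀ χ : DirichletCharacter ℂ m, charSum m ι χ x = charSum m ι χ y) : x = y := by
  have h1 := apply_sigma_eq_of_forall_charSum_eq m ι h 1
  have hσ1 : sigma m 1 = AlgEquiv.refl := by
    unfold sigma
    rw [map_one]
    rfl
  rw [hσ1] at h1
  exact ι.injective h1

/-- `charSum` is additive in `x`. [folklore] -/
theorem charSum_add (χ : DirichletCharacter ℂ m) (x y : CyclotomicField m ℚ) :
    charSum m ι χ (x + y) = charSum m ι χ x + charSum m ι χ y := by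
  unfold charSum
  rw [← Finset.sum_add_distrib]
  refine Finset.sum_congr rfl fun b _ => ?_
  rw [map_add, map_add, mul_add]

/-- `charSum` of `0` is `0`. [folklore] -/
theorem charSum_zero (χ : DirichletCharacter ℂ m) : charSum m ι χ 0 = 0 := by
  unfold charSum
  simp

/-- `charSum` commutes with rational scalars: `charSum (q • x) = q · charSum x`. [folklore] -/
theorem charSum_smul (χ : DirichletCharacter ℂ m) (q : ℚ) (x : CyclotomicField m ℚ) :
    charSum m ι χ (q • x) = (q : ℂ) * charSum m ι χ x := by
  unfold charSum
  rw [Finset.mul_sum]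
  refine Finset.sum_congr rfl fun b _ => ?_
  rw [Algebra.smul_def, map_mul, AlgEquiv.commutes, map_mul, eq_ratCast, map_ratCast,
    mul_left_comm]

/-- **Vanishing criterion**: `x = 0` as soon as every character sum of `x` vanishes. [folklore] -/
theorem eq_zero_of_forall_charSum_eq_zero {x : CyclotomicField m ℚ}
    (h : ∀ χ : DirichletCharacter ℂ m, charSum m ι χ x = 0) : x = 0 :=
  eq_of_forall_charSum_eq m ι fun χ => by rw [h χ, charSum_zero]

/-- `charSum` of a finite sum is the sum of the `charSum`s. [folklore] -/
theorem charSum_finset_sum {α : Type*} (χ : DirichletCharacter ℂ m) (s : Finset α)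
    (f : α → CyclotomicField m ℚ) :
    charSum m ι χ (∑ i ∈ s, f i) = ∑ i ∈ s, charSum m ι χ (f i) := by
  classical
  induction s using Finset.induction_on with
  | empty => rw [Finset.sum_empty, Finset.sum_empty, charSum_zero]
  | insert a s ha ih => rw [Finset.sum_insert ha, Finset.sum_insert ha, charSum_add, ih]

/-- **The group-ring dictionary.** For coefficients `X : (ℤ/m)ˣ → ℚ` and any `z ∈ ℚ(ζ_m)`, the
element `Σ_a X(a) · σ_a z` (the group-ring element `Σ_a X(a) δ_a` applied to `z`) has character sums
`charSum χ (Σ_a X(a) σ_a z) = (Σ_a χ(a)⁻¹ X(a)) · charSum χ z` — the `χ⁻¹`-component of `X` times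
the character sum of `z` (for `z = ζ_m` the latter is the Gauss-type sum `charSum_zeta`). With
`totient_mul_apply_sigma_eq_sum_charSum` / `eq_of_forall_charSum_eq` this is how an identity of
character sums for EVERY `χ` becomes an identity of group-ring coefficients. [folklore] -/
theorem charSum_sum_smul_sigma (χ : DirichletCharacter ℂ m) (X : (ZMod m)ˣ → ℚ)
    (z : CyclotomicField m ℚ) :
    charSum m ι χ (∑ a : (ZMod m)ˣ, X a • sigma m a z) =
      (∑ a : (ZMod m)ˣ, χ⁻¹ (a : ZMod m) * (X a : ℂ)) * charSum m ι χ z := by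
  rw [charSum_finset_sum, Finset.sum_mul]
  refine Finset.sum_congr rfl fun a _ => ?_
  rw [charSum_smul, charSum_sigma, mul_assoc, mul_left_comm]

set_option backward.isDefEq.respectTransparency false in
/-- The character sum of the distinguished root of unity `ζ_m` is the Gauss-type sum
`Σ_c χ(c) · ι(ζ_m)^c` (`σ_c ζ_m = ζ_m^c`, Kato (5.7.1)). [cite: Kato2004Asterisque, (5.7.1) (p. 157)] -/
theorem charSum_zeta (χ : DirichletCharacter ℂ m) :
    charSum m ι χ (IsCyclotomicExtension.zeta m ℚ (CyclotomicField m ℚ)) =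
      ∑ c : (ZMod m)ˣ, χ (c : ZMod m) *
        ι (IsCyclotomicExtension.zeta m ℚ (CyclotomicField m ℚ)) ^ (c : ZMod m).val := by
  unfold charSum
  refine Finset.sum_congr rfl fun c _ => ?_
  rw [sigma_apply_zeta, map_pow]

set_option backward.isDefEq.respectTransparency false in
/-- **Character sums of `ζ_m` are Gauss sums.** If the embedding is normalised by
`ι(ζ_m) = e^{2πi·u/m}` for a unit `u` mod `m` (EVERY embedding `ι : ℚ(ζ_m) → ℂ` is of this form:
`ι(ζ_m)` is a primitive `m`-th root of unity in `ℂ`), then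
`charSum m ι χ ζ_m = χ(u)⁻¹ · g(χ, e_m)` with `g(χ, e_m) = Σ_{a mod m} χ(a) e^{2πi a/m}` Mathlib's
`gaussSum χ ZMod.stdAddChar` (the Gauss sum of Birch's formula `twisted_LValue_eq` in the tree).
With `charSum_sum_smul_sigma`: `charSum χ (Σ_a X(a) σ_a ζ_m) = χ(u)⁻¹ g(χ, e_m) · Σ_a χ(a)⁻¹ X(a)`.
[folklore] -/
theorem charSum_zeta_eq_inv_mul_gaussSum (χ : DirichletCharacter ℂ m) (u : (ZMod m)ˣ)
    (hι : ι (IsCyclotomicExtension.zeta m ℚ (CyclotomicField m ℚ)) =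
      Complex.exp (2 * Real.pi * Complex.I * ((u : ZMod m).val : ℂ) / m)) :
    charSum m ι χ (IsCyclotomicExtension.zeta m ℚ (CyclotomicField m ℚ)) =
      χ⁻¹ (u : ZMod m) * gaussSum χ (ZMod.stdAddChar (N := m)) := by
  rw [charSum_zeta]
  -- `ι(ζ_m)^c = e_m(u c)` for every unit `c`
  have hpow : ∀ c : (ZMod m)ˣ,
      ι (IsCyclotomicExtension.zeta m ℚ (CyclotomicField m ℚ)) ^ (c : ZMod m).val =
        ZMod.stdAddChar ((u * c : (ZMod m)ˣ) : ZMod m) := by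
    intro c
    have hcast : ((u * c : (ZMod m)ˣ) : ZMod m) =
        ((((u : ZMod m).val * (c : ZMod m).val : ℕ) : ℤ) : ZMod m) := by
      push_cast
      rw [ZMod.natCast_zmod_val, ZMod.natCast_zmod_val]
    rw [hcast, ZMod.stdAddChar_coe, hι, ← Complex.exp_nat_mul]
    congr 1
    push_cast
    ring
  simp_rw [hpow]
  -- the Gauss sum as a sum over units (χ vanishes off the units)
  have hGauss : gaussSum χ (ZMod.stdAddChar (N := m)) =
      ∑ c : (ZMod m)ˣ, χ (c : ZMod m) * ZMod.stdAddChar (c : ZMod m) := by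
    rw [gaussSum]
    symm
    have h1 : ∑ c : (ZMod m)ˣ, χ (c : ZMod m) * ZMod.stdAddChar (c : ZMod m) =
        ∑ x ∈ (Finset.univ : Finset (ZMod m)ˣ).map ⟨Units.val, fun _ _ h => Units.ext h⟩,
          χ x * ZMod.stdAddChar x := by
      rw [Finset.sum_map]
      rfl
    rw [h1]
    refine Finset.sum_subset (Finset.subset_univ _) fun x _ hx => ?_
    have hxu : ¬ IsUnit x := fun hu => hx (Finset.mem_map.2 ⟨hu.unit, Finset.mem_univ _, rfl⟩)
    rw [MulChar.map_nonunit χ hxu, zero_mul]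
  -- reindex `c ↦ u⁻¹ c`
  rw [hGauss, Finset.mul_sum, ← Equiv.sum_comp (Equiv.mulLeft u⁻¹)]
  refine Finset.sum_congr rfl fun c _ => ?_
  simp only [Equiv.coe_mulLeft]
  rw [mul_inv_cancel_left, Units.val_mul, map_mul, inv_apply_coe_units, ZMod.inv_coe_unit, mul_assoc]

set_option backward.isDefEq.respectTransparency false in
/-- Every embedding `ι : ℚ(ζ_m) → ℂ` is normalised by a unit: `ι(ζ_m) = e^{2πi·u/m}` for some
`u ∈ (ℤ/m)ˣ` (`ι(ζ_m)` is a primitive `m`-th root of unity of `ℂ`, and those are the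
`e^{2πi·i/m}`, `gcd(i, m) = 1`). [folklore] -/
theorem exists_units_apply_zeta_eq_exp :
    ∃ u : (ZMod m)ˣ, ι (IsCyclotomicExtension.zeta m ℚ (CyclotomicField m ℚ)) =
      Complex.exp (2 * Real.pi * Complex.I * ((u : ZMod m).val : ℂ) / m) := by
  have hprim : IsPrimitiveRoot (ι (IsCyclotomicExtension.zeta m ℚ (CyclotomicField m ℚ))) m :=
    (IsCyclotomicExtension.zeta_spec m ℚ (CyclotomicField m ℚ)).map_of_injective ι.injective
  obtain ⟨i, hi, hic, h⟩ :=
    (Complex.isPrimitiveRoot_exp m (NeZero.ne m)).isPrimitiveRoot_iff.mp hprim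
  refine ⟨ZMod.unitOfCoprime i hic, ?_⟩
  rw [ZMod.coe_unitOfCoprime, ZMod.val_natCast, Nat.mod_eq_of_lt hi, ← h, ← Complex.exp_nat_mul]
  congr 1
  ring

end CharSum

end Summit.BirchSwinnertonDyer.Rank1Residual.GaloisImage

end
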